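import Literature.AlgebraicGeometry.GroupSchemes.AffineGroupSchemeBaseChangeNatural  -- ★ (N2a-i) `algBaseChangeEquiv_comap_pullback_map`, `algBaseChangeEquiv_symm_map_comap` (+ ★ `algBaseChange(Bialg)Equiv`, `Alg.comap`)
import Literature.RingTheory.Flat.HopfIdealSpecialFibre                                -- ★ (ii) `specialFibre_closure_mem_carrier`, `specialFibre_closure_bot`
import Mathlib.RingTheory.Bialgebra.Quotient
import Mathlib.RingTheory.HopfAlgebra.Quotient
import HarnessLib

/-!
# The specialisation map `sp` on admissible Hopf ideals, in the currency of the base-changed group SCHEME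

Topic `Literature/AlgebraicGeometry/GroupSchemes`; namespace `Literature.AlgebraicGeometry.GroupSchemes.AffineGroupScheme`.  ONE definition (`spI`)
+ theorems; no instance, no notation, no named fact, no `sorry`.  Cell `hodgecm-mathlib` (D-0151), programme P6 «MOD» (crux hLiu418 = stmt-HodgeConjecture-24832, `--supports`, count-neutral):
organ **(D5) «(ii-J) THE `sp` MAP IN CONSTRUCTOR CURRENCY»** of the DICT-constructor head `heart_of_constructors`
(`Cruxes/HLiu418/Lines/F0_P6c_DictConstructors.lean`, desk F0P6c-plan (g2), cand v4): its binder `sp y : Line y → Sub (red y)` between the carriers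
`{J : Ideal (Alg 𝒢_K) // IsAdm}` and `{I : Ideal (Alg 𝒢_κ) // IsAdm}`.  Continues the ★ base-change files `AffineGroupSchemeBaseChange{Points,Alg,Hopf,
Natural}` and reads ★ `Literature/RingTheory/Flat/HopfIdealSpecialFibre` (A-p14, organ (ii)).  HC_CM is proved only modulo the printed citations until rung 0 closes; this
file is generic and changes no count.

THE PRINT.  [EGAIV2] Prop. 2.8.5 (schematic closure over a valuation ring is flat and commutes with the generic fibre), [GortzWedhorn2023] §(27.2)
(`Γ(G_{R′}, 𝒪) = R′ ⊗_R Γ(G, 𝒪)` for an affine group scheme `G` over `R`, functorially in `G`), [Milne2017] 1.e, 3.11, 3.15 (closed subgroup schemes of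
an affine group = Hopf ideals; kernels∕images under homomorphisms).  For an affine group scheme `𝒢 = Spec A` over a valuation ring `R` with fraction
field `K` and residue field `κ`, the ring-level specialisation map of ★ `Literature/RingTheory/Flat/HopfIdealSpecialFibre` (A-p14, (ii)),
`J ↦ (J ∩ A)·(κ ⊗_R A)` on ideals of `K ⊗_R A`, is read on the global sections of the base-changed SCHEMES `𝒢_K`, `𝒢_κ` through the ★ bialgebra
isomorphisms `e_S : Γ(𝒢_S, 𝒪) ≃ S ⊗_R Γ(𝒢, 𝒪)` (`algBaseChangeBialgEquiv`): `spI J := e_κ⁻¹((e_K(J) ∩ A)·(κ ⊗_R A))`.  The NATURALITY of `e_S`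
in `𝒢` (★ `AffineGroupSchemeBaseChangeNatural`, B-p04: `e ∘ Γ(b_S) = (1 ⊗ Γ(b)) ∘ e`) carries stability under a family of endomorphisms `β a`
across `e` (§2); Hopf ideals cross the bialgebra isomorphisms `e_S` by §1 (MILNE 3.11 for a surjective map, over any commutative ring).  With these,
(ii)'s carrier theorem gives: `spI` sends an admissible ideal (Hopf, corank `r`, `β`-stable) of `Γ(𝒢_K)` to an admissible ideal of `Γ(𝒢_κ)`, and
`spI ⊥ = ⊥` (§3).

## Contents
* §1 HOPF IDEALS ALONG BIALGEBRA EQUIVALENCES over any commutative ring: `isCoideal_ker_bialgHom_of_surjective`,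
  `isHopfIdeal_ker_bialgHom_of_surjective` (MILNE 3.11 for a SURJECTIVE map — no field needed), **`isHopfIdeal_comap_bialgEquiv`**,
  private plumbing `map_algEquiv_eq_comap_symm` ∕ `map_algEquiv_coe_ringHom`;
* §2 IDEALS ACROSS `e_S`: `map_map_le_map_of_map_comap_le` ∕ `map_comap_le_comap_of_map_le` (stability under `Γ(b_S)` ↔ stability under
  `1 ⊗ Γ(b)`);
* §3 THE MAP: **`spI`**, `spI_eq`, the two transports `isHopfIdeal_and_finrank_and_map_le_map_algBaseChangeEquiv` (to `K ⊗_R Γ(𝒢)`) and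
  `isHopfIdeal_and_finrank_and_map_le_comap_algBaseChangeEquiv` (from `κ ⊗_R Γ(𝒢)`), **`isHopfIdeal_and_finrank_and_map_le_spI`** (= the DICT
  binder `sp y` with `IsAdm` unfolded), **`spI_bot`**.

## References
* [EGAIV2] A. Grothendieck, *Éléments de géométrie algébrique* IV₂, Publ. Math. IHÉS 24 (1965): Prop. 2.8.5.
* [GortzWedhorn2023] U. Görtz, T. Wedhorn, *Algebraic Geometry II*, Springer (2023): §(27.2) (27.2.1), Definition 27.6 (pp. 606–607).
* [GortzWedhorn2020] U. Görtz, T. Wedhorn, *Algebraic Geometry I*, 2nd ed. (2020): (4.7.1) (p. 108), (4.15), Definition 4.42 (p. 116).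
* [Milne2017] J. S. Milne, *Algebraic Groups*, CUP (2017): Ch. 1 §e, Ch. 3 §b Def. 3.10, Props. 3.11, 3.15.
-/

set_option autoImplicit false

-- Mathlib's `Over`/`Scheme` APIs are stated across semireducible wrappers (as in the ★ `GroupSchemes/*` base-change files).
set_option backward.isDefEq.respectTransparency false

universe u

open CategoryTheory CategoryTheory.Limits AlgebraicGeometry MonoidalCategory CartesianMonoidalCategory TensorProduct WithConv

noncomputable section

namespace Literature.AlgebraicGeometry.GroupSchemes

namespace AffineGroupScheme

open scoped MonObj CategoryTheory.Obj

open Literature.AlgebraicGeometry.Motives Literature.NumberTheory.DiophantineGeometry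

/-! ## §1 Hopf ideals along bialgebra equivalences (any commutative base ring) -/

section HopfTransport

open Coalgebra

variable {S : Type*} [CommRing S] {A B : Type*} [CommRing A] [CommRing B]

/-- **The kernel of a SURJECTIVE bialgebra map is a coideal** (over any commutative ring `S`): `ε(ker f) = 0` and `(π ⊗ π)Δ(ker f) = 0`
for `π : A → A ⧸ ker f`, because `f ⊗ f = (f̄ ⊗ f̄)(π ⊗ π)` with `f̄ : A ⧸ ker f ≅ B` a linear ISOMORPHISM (surjectivity) and `(f ⊗ f)Δ = Δ f`.
[cite: Milne2017, Ch. 3 §b Def. 3.10, Prop. 3.11 («The kernel of a homomorphism of Hopf k-algebras is a Hopf ideal»)] -/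
theorem isCoideal_ker_bialgHom_of_surjective [Bialgebra S A] [Bialgebra S B] (f : A →ₐc[S] B) (hf : Function.Surjective f) :
    ((RingHom.ker (f : A →ₐ[S] B)).restrictScalars S).IsCoideal := by
  let I : Submodule S A := (RingHom.ker (f : A →ₐ[S] B)).restrictScalars S
  have hIf : I = LinearMap.ker (f : A →ₗ[S] B) := Submodule.ext fun _ => Iff.rfl
  let fbar : (A ⧸ I) →ₗ[S] B := I.liftQ (f : A →ₗ[S] B) hIf.le
  have hfbar : fbar ∘ₗ I.mkQ = (f : A →ₗ[S] B) := I.liftQ_mkQ _ hIf.le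
  have hinj : Function.Injective fbar := LinearMap.ker_eq_bot.1 (Submodule.ker_liftQ_eq_bot _ _ _ hIf.ge)
  have hsurj : Function.Surjective fbar := fun b => by
    obtain ⟨a, rfl⟩ := hf b
    exact ⟨I.mkQ a, by rw [← LinearMap.comp_apply, hfbar]; rfl⟩
  let g : B →ₗ[S] (A ⧸ I) := (LinearEquiv.ofBijective fbar ⟨hinj, hsurj⟩).symm.toLinearMap
  have hg : g ∘ₗ fbar = LinearMap.id :=
    LinearMap.ext fun x => (LinearEquiv.ofBijective fbar ⟨hinj, hsurj⟩).symm_apply_apply x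
  refine ⟨fun x hx => ?_, fun x hx => ?_⟩
  · have h0 : f x = 0 := hx
    rw [← CoalgHomClass.counit_comp_apply f x, h0, map_zero]
  · have h0 : f x = 0 := hx
    have hff := CoalgHomClass.map_comp_comul_apply f x
    rw [h0, map_zero] at hff
    have e : TensorProduct.map I.mkQ I.mkQ (comul x) =
        TensorProduct.map g g (TensorProduct.map fbar fbar (TensorProduct.map I.mkQ I.mkQ (comul x))) := by
      rw [← LinearMap.comp_apply (TensorProduct.map g g), ← TensorProduct.map_comp, hg, TensorProduct.map_id,
        LinearMap.id_apply]
    change TensorProduct.map I.mkQ I.mkQ (comul x) = 0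
    rw [e, ← LinearMap.comp_apply (TensorProduct.map fbar fbar), ← TensorProduct.map_comp, hfbar, hff, map_zero]

/-- `(S_B ∘ f) ⋆ f = 1` in Mathlib's convolution group `Hom_{S-alg}(A, B)` (commutative Hopf algebras): the coinverse axiom `S_B ⋆ id_B = 1`
precomposed with the bialgebra map `f`. [cite: Milne2017, Ch. 3 §b 3.4 (19) («f ∘ S_A = S_B ∘ f»)] -/
private theorem toConv_antipodeAlgHom_comp_mul [HopfAlgebra S A] [HopfAlgebra S B] (f : A →ₐc[S] B) :
    toConv ((HopfAlgebra.antipodeAlgHom S B).comp (f : A →ₐ[S] B)) * toConv (f : A →ₐ[S] B) = 1 := by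
  apply WithConv.ofConv_injective
  have h := AlgHom.convMul_comp_bialgHom_distrib (toConv (HopfAlgebra.antipodeAlgHom S B)) (toConv (AlgHom.id S B)) f
  rw [AlgHom.antipode_id_cancel, WithConv.ofConv_toConv, WithConv.ofConv_toConv, AlgHom.id_comp] at h
  rw [← h, AlgHom.convOne_def, AlgHom.convOne_def, WithConv.ofConv_toConv, WithConv.ofConv_toConv, AlgHom.comp_assoc,
    BialgHom.counitAlgHom_comp]

/-- **`f ∘ S_A = S_B ∘ f`** for a bialgebra map of commutative Hopf algebras: both sides are the inverse of `f` in the convolution group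
`Hom_{S-alg}(A, B)` (Mathlib's `inv` there is `φ ↦ φ ∘ S_A` by definition). [cite: Milne2017, Ch. 3 §b 3.4 (19) («f ∘ S_A = S_B ∘ f»)] -/
private theorem bialgHom_map_antipode [HopfAlgebra S A] [HopfAlgebra S B] (f : A →ₐc[S] B) (a : A) :
    f (HopfAlgebra.antipode S a) = HopfAlgebra.antipode S (f a) := by
  have h : (toConv (f : A →ₐ[S] B))⁻¹ = toConv ((HopfAlgebra.antipodeAlgHom S B).comp (f : A →ₐ[S] B)) :=
    inv_eq_of_mul_eq_one_left (toConv_antipodeAlgHom_comp_mul f)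
  exact congr_arg (fun ψ : A →ₐ[S] B => ψ a) (WithConv.toConv_injective h)

/-- **MILNE 3.11 for a surjective map, over any commutative ring: the kernel of a surjective homomorphism of (commutative) Hopf algebras is a
Hopf ideal** (§1 coideal + `f ∘ S_A = S_B ∘ f`). [cite: Milne2017, Ch. 3 §b Prop. 3.11, Prop. 3.15] -/
theorem isHopfIdeal_ker_bialgHom_of_surjective [HopfAlgebra S A] [HopfAlgebra S B] (f : A →ₐc[S] B) (hf : Function.Surjective f) :
    (RingHom.ker (f : A →ₐ[S] B)).IsHopfIdeal S :=
  { isCoideal_ker_bialgHom_of_surjective f hf with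
    antipode_mem := fun x hx => by
      have h0 : f x = 0 := hx
      change f (HopfAlgebra.antipode S x) = 0
      rw [bialgHom_map_antipode, h0, map_zero] }

/-- **Hopf ideals pull back along bialgebra ISOMORPHISMS** (any commutative base ring): `e⁻¹(I)` is the kernel of the surjective Hopf map
`A → B → B ⧸ I`. [cite: Milne2017, Ch. 3 §b Prop. 3.11, 3.12] -/
theorem isHopfIdeal_comap_bialgEquiv [HopfAlgebra S A] [HopfAlgebra S B] (e : A ≃ₐc[S] B) {I : Ideal B} (hI : I.IsHopfIdeal S) :
    (I.comap e).IsHopfIdeal S := by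
  haveI := hI
  haveI : (I.restrictScalars S).IsCoideal := hI.toIsCoideal
  have h : I.comap e =
      RingHom.ker (((Bialgebra.Quotient.mkBialgHom I).comp (e : A →ₐc[S] B) : A →ₐc[S] B ⧸ I) : A →ₐ[S] B ⧸ I) := by
    ext a
    rw [Ideal.mem_comap, RingHom.mem_ker]
    exact (Ideal.Quotient.eq_zero_iff_mem).symm
  rw [h]
  refine isHopfIdeal_ker_bialgHom_of_surjective _ fun y => ?_
  obtain ⟨b, rfl⟩ := Ideal.Quotient.mk_surjective y
  exact ⟨e.symm b, by
    change Ideal.Quotient.mk I (e (e.symm b)) = Ideal.Quotient.mk I b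
    rw [BialgEquiv.apply_symm_apply]⟩

/-- Along an algebra isomorphism `e`, the image of an ideal is its preimage under `e⁻¹` (Mathlib `Ideal.map_comap_of_equiv` in the `AlgEquiv`
coercion; plumbing). [folklore] -/
private theorem map_algEquiv_eq_comap_symm [Algebra S A] [Algebra S B] (e : A ≃ₐ[S] B) (J : Ideal A) : J.map e = J.comap e.symm :=
  le_antisymm (Ideal.map_le_comap_of_inverse _ _ _ e.symm_apply_apply) (Ideal.comap_le_map_of_inverse _ _ _ e.apply_symm_apply)

/-- The image of an ideal along `e` in the `RingHom` coercion is the image in the `AlgEquiv` coercion (the shape Mathlib's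
`Ideal.quotientEquivAlg` asks for; plumbing). [folklore] -/
private theorem map_algEquiv_coe_ringHom [Algebra S A] [Algebra S B] (e : A ≃ₐ[S] B) (J : Ideal A) : J.map (e : A →+* B) = J.map e := rfl

end HopfTransport

/-! ## §2 Stability of ideals across the base-change isomorphism -/

section Stability

variable {R : Type u} [CommRing R] (R' : Type u) [CommRing R'] [Algebra R R'] {G : SchemeOver R} [GrpObj G] [IsAffine G.left]
  [IsAffine ((Over.pullback (Spec.map (CommRingCat.ofHom (algebraMap R R')))).obj G).left] (b : G ⟶ G)

/-- **Stability descends along `e`**: for an endomorphism `b : G → G` of the `R`-scheme `G` and an ideal `J ⊂ Γ(G_{R′}, 𝒪)`, if `Γ(b_{R′})(J) ⊆ J`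
then `(id ⊗ Γ(b))(e J) ⊆ e J` in `R′ ⊗_R Γ(G, 𝒪)` (★ naturality `algBaseChangeEquiv_symm_map_comap`: `e⁻¹ ∘ (id ⊗ Γ(b)) = Γ(b_{R′}) ∘ e⁻¹`).
[cite: GortzWedhorn2023, §(27.2) (27.2.1) (pp. 606–607)] [cite: Milne2017, Ch. 1 §e] -/
theorem map_map_le_map_of_map_comap_le (J : Ideal (Alg ((Over.pullback (Spec.map (CommRingCat.ofHom (algebraMap R R')))).obj G)))
    (hJ : J.map (Alg.comap ((Over.pullback (Spec.map (CommRingCat.ofHom (algebraMap R R')))).map b)) ≤ J) :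
    (J.map (algBaseChangeEquiv R' G)).map (Algebra.TensorProduct.map (AlgHom.id R' R') (Alg.comap b)) ≤ J.map (algBaseChangeEquiv R' G) := by
  rw [map_algEquiv_eq_comap_symm, Ideal.map_le_iff_le_comap]
  intro y hy
  rw [Ideal.mem_comap] at hy ⊢
  rw [Ideal.mem_comap, algBaseChangeEquiv_symm_map_comap]
  exact hJ (Ideal.mem_map_of_mem _ hy)

/-- **Stability ascends along `e`**: if `(id ⊗ Γ(b))(I) ⊆ I` for an ideal `I ⊂ R′ ⊗_R Γ(G, 𝒪)`, then `Γ(b_{R′})(e⁻¹ I) ⊆ e⁻¹ I` in `Γ(G_{R′}, 𝒪)`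
(★ naturality `algBaseChangeEquiv_comap_pullback_map`: `e ∘ Γ(b_{R′}) = (id ⊗ Γ(b)) ∘ e`). [cite: GortzWedhorn2023, §(27.2) (27.2.1) (pp. 606–607)]
[cite: Milne2017, Ch. 1 §e] -/
theorem map_comap_le_comap_of_map_le (I : Ideal (R' ⊗[R] Alg G))
    (hI : I.map (Algebra.TensorProduct.map (AlgHom.id R' R') (Alg.comap b)) ≤ I) :
    (I.comap (algBaseChangeEquiv R' G)).map (Alg.comap ((Over.pullback (Spec.map (CommRingCat.ofHom (algebraMap R R')))).map b)) ≤
      I.comap (algBaseChangeEquiv R' G) := by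
  rw [Ideal.map_le_iff_le_comap]
  intro x hx
  rw [Ideal.mem_comap] at hx ⊢
  rw [Ideal.mem_comap, algBaseChangeEquiv_comap_pullback_map]
  exact hI (Ideal.mem_map_of_mem _ hx)

end Stability

/-! ## §3 The specialisation map on ideals of `Γ(𝒢_K, 𝒪)` -/

section SpecialFibre

variable {R : Type u} [CommRing R] (K κ : Type u) [Field K] [Algebra R K] [Field κ] [Algebra R κ]
  (G : SchemeOver R) [GrpObj G] [IsAffine G.left]
  [IsAffine ((Over.pullback (Spec.map (CommRingCat.ofHom (algebraMap R K)))).obj G).left]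
  [IsAffine ((Over.pullback (Spec.map (CommRingCat.ofHom (algebraMap R κ)))).obj G).left]

/-- **HEAD — the specialisation map `sp` on ideals of `Γ(𝒢_K, 𝒪)`**: `spI J := e_κ⁻¹((e_K(J) ∩ A)·(κ ⊗_R A))`, `A = Γ(𝒢, 𝒪)`, `e_S = algBaseChangeEquiv`
— the ideal of the special fibre of the schematic closure in `𝒢` of the closed subscheme `V(J) ⊂ 𝒢_K`, read on `Γ(𝒢_κ, 𝒪)`.
[cite: EGAIV2, Prop. 2.8.5] [cite: GortzWedhorn2023, §(27.2) (27.2.1) (pp. 606–607)] -/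
def spI (J : Ideal (Alg ((Over.pullback (Spec.map (CommRingCat.ofHom (algebraMap R K)))).obj G))) :
    Ideal (Alg ((Over.pullback (Spec.map (CommRingCat.ofHom (algebraMap R κ)))).obj G)) :=
  (((J.map (algBaseChangeEquiv K G)).comap (Algebra.TensorProduct.includeRight : Alg G →ₐ[R] K ⊗[R] Alg G)).map
      (Algebra.TensorProduct.includeRight : Alg G →ₐ[R] κ ⊗[R] Alg G)).comap (algBaseChangeEquiv κ G)

/-- Unfolding `spI`. [cite: EGAIV2, Prop. 2.8.5] -/
theorem spI_eq (J : Ideal (Alg ((Over.pullback (Spec.map (CommRingCat.ofHom (algebraMap R K)))).obj G))) :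
    spI K κ G J =
      (((J.map (algBaseChangeEquiv K G)).comap (Algebra.TensorProduct.includeRight : Alg G →ₐ[R] K ⊗[R] Alg G)).map
        (Algebra.TensorProduct.includeRight : Alg G →ₐ[R] κ ⊗[R] Alg G)).comap (algBaseChangeEquiv κ G) := rfl

/-- **Transport to `K ⊗_R Γ(𝒢)`**: an admissible ideal `J` of `Γ(𝒢_K, 𝒪)` (Hopf, corank `r`, stable under the `Γ((β a)_K)`) has admissible
image `e_K(J)` (Hopf — §1 along the bialgebra isomorphism `e_K`; corank `r` — Mathlib `Ideal.quotientEquivAlg`; stable under the `1 ⊗ Γ(β a)` — §2).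
[cite: Milne2017, 1.e, Ch. 3 §b Props. 3.11 and 3.15] [cite: GortzWedhorn2023, §(27.2) (27.2.1) (pp. 606–607)] -/
theorem isHopfIdeal_and_finrank_and_map_le_map_algBaseChangeEquiv {σ : Type*} (β : σ → (G ⟶ G)) (r : ℕ)
    (J : Ideal (Alg ((Over.pullback (Spec.map (CommRingCat.ofHom (algebraMap R K)))).obj G)))
    (hJ : J.IsHopfIdeal K ∧
      Module.finrank K (Alg ((Over.pullback (Spec.map (CommRingCat.ofHom (algebraMap R K)))).obj G) ⧸ J) = r ∧
      ∀ a, J.map ((Over.pullback (Spec.map (CommRingCat.ofHom (algebraMap R K)))).map (β a)).left.appTop.hom ≤ J) :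
    (J.map (algBaseChangeEquiv K G)).IsHopfIdeal K ∧
      Module.finrank K ((K ⊗[R] Alg G) ⧸ J.map (algBaseChangeEquiv K G)) = r ∧
      ∀ a, (J.map (algBaseChangeEquiv K G)).map (Algebra.TensorProduct.map (AlgHom.id K K) (Alg.comap (β a))) ≤
        J.map (algBaseChangeEquiv K G) := by
  obtain ⟨hH, hr, hβ⟩ := hJ
  refine ⟨?_, ?_, fun a => map_map_le_map_of_map_comap_le K (β a) J (hβ a)⟩
  · -- `e_K(J) = (e_K⁻¹)⁻¹(J)` is a Hopf ideal (§1 along the bialgebra isomorphism `e_K⁻¹`)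
    have hJ' : J.map (algBaseChangeEquiv K G) = J.comap (algBaseChangeBialgEquiv K G).symm :=
      (map_algEquiv_eq_comap_symm (algBaseChangeEquiv K G) J).trans (Ideal.ext fun _ => Iff.rfl)
    rw [hJ']
    exact isHopfIdeal_comap_bialgEquiv (algBaseChangeBialgEquiv K G).symm hH
  · rw [← hr]
    exact (Ideal.quotientEquivAlg J (J.map (algBaseChangeEquiv K G)) (algBaseChangeEquiv K G)
      (map_algEquiv_coe_ringHom (algBaseChangeEquiv K G) J).symm).toLinearEquiv.finrank_eq.symm

/-- **Transport from `κ ⊗_R Γ(𝒢)`**: an admissible ideal `I` of `κ ⊗_R Γ(𝒢)` (Hopf, corank `r`, stable under the `1 ⊗ Γ(β a)`) has admissible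
preimage `e_κ⁻¹(I)` in `Γ(𝒢_κ, 𝒪)` (Hopf — §1; corank — Mathlib `Ideal.quotientEquivAlg` along `e_κ⁻¹`; stable under the `Γ((β a)_κ)` — §2).
[cite: Milne2017, 1.e, Ch. 3 §b Props. 3.11 and 3.15] [cite: GortzWedhorn2023, §(27.2) (27.2.1) (pp. 606–607)] -/
theorem isHopfIdeal_and_finrank_and_map_le_comap_algBaseChangeEquiv {σ : Type*} (β : σ → (G ⟶ G)) (r : ℕ)
    (I : Ideal (κ ⊗[R] Alg G))
    (hI : I.IsHopfIdeal κ ∧ Module.finrank κ ((κ ⊗[R] Alg G) ⧸ I) = r ∧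
      ∀ a, I.map (Algebra.TensorProduct.map (AlgHom.id κ κ) (Alg.comap (β a))) ≤ I) :
    (I.comap (algBaseChangeEquiv κ G)).IsHopfIdeal κ ∧
      Module.finrank κ (Alg ((Over.pullback (Spec.map (CommRingCat.ofHom (algebraMap R κ)))).obj G) ⧸
        I.comap (algBaseChangeEquiv κ G)) = r ∧
      ∀ a, (I.comap (algBaseChangeEquiv κ G)).map
          ((Over.pullback (Spec.map (CommRingCat.ofHom (algebraMap R κ)))).map (β a)).left.appTop.hom ≤
        I.comap (algBaseChangeEquiv κ G) := by
  obtain ⟨hH, hr, hβ⟩ := hI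
  refine ⟨?_, ?_, fun a => map_comap_le_comap_of_map_le κ (β a) I (hβ a)⟩
  · have h : I.comap (algBaseChangeEquiv κ G) = I.comap (algBaseChangeBialgEquiv κ G) := by
      ext x
      simp only [Ideal.mem_comap, algBaseChangeBialgEquiv_apply]
    rw [h]
    exact isHopfIdeal_comap_bialgEquiv (algBaseChangeBialgEquiv κ G) hH
  · rw [← hr]
    refine (Ideal.quotientEquivAlg _ _ (algBaseChangeEquiv κ G).symm ?_).toLinearEquiv.finrank_eq.symm
    rw [map_algEquiv_coe_ringHom, map_algEquiv_eq_comap_symm, AlgEquiv.symm_symm]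

variable [IsDomain R] [ValuationRing R] [IsFractionRing R K]

/-- **HEAD (S1) — `sp` maps admissible ideals to admissible ideals**: for `𝒢` an affine group scheme over a valuation ring `R`, module-finite,
with fraction field `K`, a field `κ` over `R` (the residue field) and a family of endomorphisms `β a : 𝒢 → 𝒢`: if `J ⊂ Γ(𝒢_K, 𝒪)` is a Hopf ideal of
corank `r` stable under every `Γ((β a)_K)`, then `spI J ⊂ Γ(𝒢_κ, 𝒪)` is a Hopf ideal of corank `r` stable under every `Γ((β a)_κ)` — ★ (ii)
`specialFibre_closure_mem_carrier` between the two transports above.  This is the DICT binder `sp y : Line y → Sub (red y)` with `IsAdm`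
unfolded. [cite: EGAIV2, Prop. 2.8.5] [cite: Milne2017, 1.e, Ch. 3 §b Props. 3.11 and 3.15] [cite: GortzWedhorn2023, §(27.2) (27.2.1) (pp. 606–607)] -/
theorem isHopfIdeal_and_finrank_and_map_le_spI [Module.Finite R (Alg G)] {σ : Type*} (β : σ → (G ⟶ G)) (r : ℕ)
    (J : Ideal (Alg ((Over.pullback (Spec.map (CommRingCat.ofHom (algebraMap R K)))).obj G)))
    (hJ : J.IsHopfIdeal K ∧
      Module.finrank K (Alg ((Over.pullback (Spec.map (CommRingCat.ofHom (algebraMap R K)))).obj G) ⧸ J) = r ∧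
      ∀ a, J.map ((Over.pullback (Spec.map (CommRingCat.ofHom (algebraMap R K)))).map (β a)).left.appTop.hom ≤ J) :
    (spI K κ G J).IsHopfIdeal κ ∧
      Module.finrank κ (Alg ((Over.pullback (Spec.map (CommRingCat.ofHom (algebraMap R κ)))).obj G) ⧸ spI K κ G J) = r ∧
      ∀ a, (spI K κ G J).map ((Over.pullback (Spec.map (CommRingCat.ofHom (algebraMap R κ)))).map (β a)).left.appTop.hom ≤ spI K κ G J := by
  obtain ⟨hH, hr, hb⟩ := isHopfIdeal_and_finrank_and_map_le_map_algBaseChangeEquiv K G β r J hJ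
  haveI := hH
  exact isHopfIdeal_and_finrank_and_map_le_comap_algBaseChangeEquiv κ G β r _
    (Literature.RingTheory.Flat.specialFibre_closure_mem_carrier (R := R) (K := K) (κ := κ) (fun a => Alg.comap (β a)) r
      (J.map (algBaseChangeEquiv K G)) hr hb)

omit [IsDomain R] [ValuationRing R] in
/-- **HEAD (S2) — `sp` of the whole group is the whole group**: `spI ⊥ = ⊥` (`Γ(𝒢, 𝒪)` flat over `R`; ★ (ii) `specialFibre_closure_bot`).
[cite: EGAIV2, Prop. 2.8.5] -/
theorem spI_bot [Module.Flat R (Alg G)] :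
    spI K κ G (⊥ : Ideal (Alg ((Over.pullback (Spec.map (CommRingCat.ofHom (algebraMap R K)))).obj G))) = ⊥ := by
  rw [spI_eq, Ideal.map_bot, Literature.RingTheory.Flat.specialFibre_closure_bot (K := K), Ideal.comap_bot_of_injective _ (algBaseChangeEquiv κ G).injective]

end SpecialFibre

end AffineGroupScheme

end Literature.AlgebraicGeometry.GroupSchemes

end
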